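import Literature.Analysis.InnerProduct.ClosedRangeTheoremHilbert
import HarnessLib

/-!
# Harmonic space and cohomology of a Hilbert complex: `𝔥 ≅ Ker S / cl Im T` (weak de Rham / Hodge
# isomorphism), `𝔥 ≅ Ker S / Im T` for closed range, the dual isomorphisms, and the harmonic representative
# as the element of least norm (Arnold–Falk–Winther 2010 §3.1.3; Bei 2014 §1; Brüning–Lesch 1992 §2)

Layer `Literature/Analysis/InnerProduct`, namespace `Literature.Analysis.InnerProduct`; sequel BY NAME of
`ClosedDenselyDefinedHilbertComplex.lean` (Demailly VIII Thm 1.1–1.2: `orthogonal_range_eq_ker_adjoint`,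
`closure_range_le_ker`, the weak Hodge decomposition `ker_eq_inf_sup_closure_range` and its orthogonality
`isOrtho_inf_closure_range` / `isOrtho_inf_closure_range_adjoint`, `range_adjoint_le_pmapKer_adjoint`,
`adjoint_adjoint_of_isClosed`) and of `ClosedRangeTheoremHilbert.lean` (Kato IV Thm 5.13:
`isClosed_range_adjoint_of_isClosed_range`, `ker_eq_inf_sup_range`). Lane `lit-hodgefound` (Track 2
foundations library), prover seat `lit-hodgefound-p06` (generation 31), self-proposed row g31-#3.
THEOREMS ONLY (no definition, no named fact). For a closed densely defined complex `H₁ →T H₂ →S H₃`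
(`Im T ⊆ Ker S`) the harmonic space is `𝔥 = Ker S ⊓ Ker T*` =
`(LinearMap.ker S.toFun).map S.domain.subtype ⊓ (LinearMap.ker T†.toFun).map T†.domain.subtype`, the reduced
cohomology is the quotient of `Ker S` by `cl Im T` (as the submodule
`((LinearMap.range T.toFun).topologicalClosure).comap (Ker S).subtype` of `Ker S`), and "`𝔥 ≅ Ker S / cl Im T`"
is stated as the bijectivity of the linear map `𝔥 → Ker S → Ker S ⧸ cl Im T` (inclusion followed by the
quotient map), together with `Nonempty (𝔥 ≃ₗ[𝕜] Ker S ⧸ cl Im T)`.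

## Sources, verbatim

D. N. Arnold, R. S. Falk, R. Winther, *Finite element exterior calculus: from Hodge theory to numerical
stability*, Bull. AMS 47 (2010), §3.1.3 (held text `paper:arxiv-0906.4325`, p0015): "Utilizing the inner
product, we define the space of harmonic forms `𝔥^k = 𝔷^k ∩ 𝔅^{k⊥}`, the orthogonal complement of `𝔅^k` in
`𝔷^k`. It is isomorphic to the reduced cohomology space `𝔷^k / cl 𝔅^k` or, for a closed complex, to the
cohomology space `𝔷^k/𝔅^k`. … Thus `𝔥^k = 𝔷^k ∩ 𝔷^*_k` is the space of harmonic forms both for the original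
complex and the dual complex."

F. Bei, *On the L²-Poincaré duality for incomplete Riemannian manifolds* (2014), §1 p. 5 (held text
`paper:arxiv-1401.2766`, p0005): "The reduced cohomology groups of the complex are:
`H̄^i(H_*, D_*) := ker(D_i)/(cl im(D_{i−1}))`. By the above proposition [the weak Kodaira decomposition
`H_i = 𝓗^i ⊕ cl im(D_{i−1}) ⊕ cl im(D_i*)`, [BL] Lemma 2.1] there is a pair of weak de Rham isomorphism
theorems: `𝓗^i(H_j, D_j) ≅ H̄^i(H_j, D_j)`, `𝓗^i(H_j, D_j) ≅ H̄^{n−i}(H_j, (D_j)*)` where in the second case we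
mean the cohomology of the dual Hilbert complex."

Here `𝔷^k = ker D_i = Ker S`, `𝔅^k = im D_{i−1} = Im T`, `𝔅^{k⊥} ∩ 𝔷^k = Ker S ∩ Ker T*` (since
`(Im T)^⊥ = Ker T*`, `pmapKer_inf_orthogonal_range_eq_harmonic`), and the dual complex is `H₃ →S* H₂ →T* H₁`,
whose cocycles in `H₂` are `Ker T*` and whose coboundaries are `Im S*`.

## What is proved (`𝕜 = ℝ` or `ℂ`; `T : E →ₗ.[𝕜] F`, `S : F →ₗ.[𝕜] G` closed densely defined, `Im T ⊆ Ker S`)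

* `pmapKer_inf_orthogonal_range_eq_harmonic` (AFW's `𝔥 = 𝔷 ∩ 𝔅^⊥` is `Ker S ∩ Ker T*`),
  `pmapKer_inf_orthogonal_harmonic_eq_closure_range` (`𝔷 ∩ 𝔥^⊥ = cl 𝔅`).
* **`bijective_mkQ_comp_inclusion_harmonic`** / `nonempty_linearEquiv_harmonic_quotient_closure_range`
  (`𝔥 ≅ Ker S / cl Im T`, the weak de Rham isomorphism); for `Im T` closed:
  **`bijective_mkQ_comp_inclusion_harmonic_of_isClosed_range`** /
  `nonempty_linearEquiv_harmonic_quotient_range` (`𝔥 ≅ Ker S / Im T`).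
* The dual complex: `bijective_mkQ_comp_inclusion_harmonic_dual` /
  `nonempty_linearEquiv_harmonic_quotient_closure_range_adjoint` (`𝔥 ≅ Ker T* / cl Im S*`) and, for `Im S`
  closed, `bijective_mkQ_comp_inclusion_harmonic_dual_of_isClosed_range` /
  `nonempty_linearEquiv_harmonic_quotient_range_adjoint` (`𝔥 ≅ Ker T* / Im S*`).
* Harmonic representatives: **`existsUnique_harmonic_sub_mem_closure_range`** (every `x ∈ Ker S` has a unique
  `h ∈ 𝔥` with `x − h ∈ cl Im T`), `existsUnique_harmonic_sub_mem_range` (closed range: `x − h ∈ Im T`),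
  `norm_add_sq_of_mem_harmonic_of_mem_closure_range` and **`norm_le_norm_add_of_mem_harmonic`** (the
  harmonic representative is the element of least norm in its class: `‖h‖ ≤ ‖h + b‖` for `b ∈ cl Im T`, with
  equality only for `b = 0`, `eq_zero_of_norm_add_eq_norm_of_mem_harmonic`).

## References

* [ArnoldFalkWinther2010] D. N. Arnold, R. S. Falk, R. Winther, *Finite element exterior calculus: from
  Hodge theory to numerical stability*, Bull. AMS 47 (2010), §3.1.3 (harmonic forms `𝔥 = 𝔷 ∩ 𝔅^⊥`,
  isomorphism with the (reduced) cohomology, `𝔥` for the dual complex).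
* [Bei2014] F. Bei, *On the L²-Poincaré duality for incomplete Riemannian manifolds: a general construction
  with applications* (2014), arXiv:1401.2766, §1 p. 5 (reduced cohomology, weak de Rham isomorphisms
  `𝓗^i ≅ H̄^i`, `𝓗^i ≅ H̄^{n−i}` of the dual complex).
* [BruningLesch1992] J. Brüning, M. Lesch, *Hilbert complexes*, J. Funct. Anal. 108 (1992), §2 (2.3),
  (2.3*), (2.8a/b), Lemma 2.1.
* [DemaillyAGBook] J.-P. Demailly, *Complex Analytic and Differential Geometry*, Ch. VIII §1 Thm 1.2 (the
  decompositions used, through `ClosedDenselyDefinedHilbertComplex.lean`).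
-/

noncomputable section

open scoped InnerProductSpace LinearPMap

namespace Literature.Analysis.InnerProduct

/-! ### A quotient lemma: `H ≅ K / B` when `K ⊆ H + B` and `H ⟂ B` inside `K` -/

section Quotient

variable {𝕜 V : Type*} [RCLike 𝕜] [NormedAddCommGroup V] [InnerProductSpace 𝕜 V]

/-- If `H, B ⊆ K`, `K ⊆ H + B` and `H ⟂ B`, then `H → K → K ⧸ B` (inclusion, then quotient map) is a linear
bijection. [folklore] -/
private theorem bijective_mkQ_comp_inclusion {K H B : Submodule 𝕜 V} (hH : H ≤ K)
    (hsup : K ≤ H ⊔ B) (horth : H ⟂ B) :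
    Function.Bijective ((B.comap K.subtype).mkQ ∘ₗ Submodule.inclusion hH) := by
  constructor
  · rw [injective_iff_map_eq_zero]
    intro h h0
    rw [LinearMap.comp_apply, Submodule.mkQ_apply, Submodule.Quotient.mk_eq_zero, Submodule.mem_comap,
      Submodule.subtype_apply, Submodule.coe_inclusion] at h0
    exact Subtype.ext (inner_self_eq_zero.1 (horth.inner_eq h.2 h0))
  · intro q
    obtain ⟨x, rfl⟩ := Submodule.mkQ_surjective _ q
    obtain ⟨h, hh, b, hb, hx⟩ := Submodule.mem_sup.1 (hsup x.2)
    refine ⟨⟨h, hh⟩, ?_⟩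
    rw [LinearMap.comp_apply, Submodule.mkQ_apply, Submodule.mkQ_apply, Submodule.Quotient.eq,
      Submodule.mem_comap]
    have e : K.subtype (Submodule.inclusion hH ⟨h, hh⟩ - x) = -b := by
      rw [map_sub, Submodule.subtype_apply, Submodule.subtype_apply, Submodule.coe_inclusion, ← hx]
      abel
    rw [e]
    exact B.neg_mem hb

/-- Pythagoras for `H ⟂ B`: `‖h + b‖² = ‖h‖² + ‖b‖²`. [folklore] -/
private theorem norm_add_sq_of_isOrtho {H B : Submodule 𝕜 V} (horth : H ⟂ B) {h b : V} (hh : h ∈ H)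
    (hb : b ∈ B) : ‖h + b‖ ^ 2 = ‖h‖ ^ 2 + ‖b‖ ^ 2 := by
  have h0 : ⟪h, b⟫_𝕜 = 0 := horth.inner_eq hh hb
  have h1 := @norm_add_sq 𝕜 _ _ _ _ h b
  rw [h0, map_zero, mul_zero, add_zero] at h1
  exact h1

end Quotient

variable {𝕜 E F G : Type*} [RCLike 𝕜]
variable [NormedAddCommGroup E] [InnerProductSpace 𝕜 E] [CompleteSpace E]
variable [NormedAddCommGroup F] [InnerProductSpace 𝕜 F] [CompleteSpace F]
variable [NormedAddCommGroup G] [InnerProductSpace 𝕜 G]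
variable {T : E →ₗ.[𝕜] F} {S : F →ₗ.[𝕜] G}

/-! ### `𝔥 = 𝔷 ∩ 𝔅^⊥ = Ker S ∩ Ker T*` and `𝔷 ∩ 𝔥^⊥ = cl 𝔅` -/

omit [CompleteSpace F] in
/-- **Arnold–Falk–Winther's harmonic space `𝔥 = 𝔷 ∩ 𝔅^⊥` is `Ker S ∩ Ker T*`** (`(Im T)^⊥ = Ker T*` for a
densely defined `T`). [cite: ArnoldFalkWinther2010, §3.1.3 "`𝔥^k = 𝔷^k ∩ 𝔅^{k⊥}` … Thus `𝔥^k = 𝔷^k ∩ 𝔷^*_k`"] -/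
theorem pmapKer_inf_orthogonal_range_eq_harmonic (hdT : Dense (T.domain : Set E)) :
    (LinearMap.ker S.toFun).map S.domain.subtype ⊓ (LinearMap.range T.toFun)ᗮ =
      (LinearMap.ker S.toFun).map S.domain.subtype ⊓ (LinearMap.ker T†.toFun).map T†.domain.subtype := by
  rw [orthogonal_range_eq_ker_adjoint hdT]

/-- **`𝔷 ∩ 𝔥^⊥ = cl 𝔅`**: inside `Ker S`, the orthogonal complement of the harmonic space is `cl Im T` (from
`Ker S = 𝔥 ⊕ cl Im T`). [cite: ArnoldFalkWinther2010, §3.1.3 "the orthogonal complement of `𝔅^k` in `𝔷^k`"; Bei2014, §1 Prop 1.1] -/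
theorem pmapKer_inf_orthogonal_harmonic_eq_closure_range (hdT : Dense (T.domain : Set E)) (hcS : S.IsClosed)
    (hST : LinearMap.range T.toFun ≤ (LinearMap.ker S.toFun).map S.domain.subtype) :
    (LinearMap.ker S.toFun).map S.domain.subtype ⊓
        ((LinearMap.ker S.toFun).map S.domain.subtype ⊓ (LinearMap.ker T†.toFun).map T†.domain.subtype)ᗮ =
      (LinearMap.range T.toFun).topologicalClosure := by
  have hB : (LinearMap.range T.toFun).topologicalClosure ≤
      ((LinearMap.ker S.toFun).map S.domain.subtype ⊓ (LinearMap.ker T†.toFun).map T†.domain.subtype)ᗮ :=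
    (isOrtho_inf_closure_range (S := S) hdT).symm.le
  refine le_antisymm ?_ (le_inf (closure_range_le_ker hcS hST) hB)
  rintro x ⟨hxK, hxH⟩
  have hx : x ∈ ((LinearMap.ker S.toFun).map S.domain.subtype ⊓
      (LinearMap.ker T†.toFun).map T†.domain.subtype) ⊔ (LinearMap.range T.toFun).topologicalClosure := by
    rw [← ker_eq_inf_sup_closure_range hdT hcS hST]
    exact hxK
  obtain ⟨h, hh, b, hb, rfl⟩ := Submodule.mem_sup.1 hx
  -- `h = (h + b) − b ∈ 𝔥^⊥ ∩ 𝔥 = 0`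
  have hh' : h ∈ ((LinearMap.ker S.toFun).map S.domain.subtype ⊓
      (LinearMap.ker T†.toFun).map T†.domain.subtype)ᗮ := by
    have e : h = (h + b) - b := (add_sub_cancel_right h b).symm
    rw [e]
    exact Submodule.sub_mem _ hxH (hB hb)
  have h0 : h = 0 := inner_self_eq_zero.1 (Submodule.inner_right_of_mem_orthogonal hh hh')
  rw [h0, zero_add]
  exact hb

/-! ### `𝔥 ≅ Ker S / cl Im T` (weak de Rham isomorphism) and `𝔥 ≅ Ker S / Im T` for closed range -/

/-- **Weak de Rham / Hodge isomorphism `𝔥 ≅ Ker S / cl Im T`**: the map "harmonic vector ↦ its reduced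
cohomology class" (inclusion `𝔥 ⊆ Ker S` followed by the quotient by `cl Im T`) is a linear bijection — every
reduced class has exactly one harmonic representative.
[cite: Bei2014, §1 p. 5 "`𝓗^i(H_j, D_j) ≅ H̄^i(H_j, D_j)`"; ArnoldFalkWinther2010, §3.1.3 "isomorphic to the reduced cohomology space `𝔷^k / cl 𝔅^k`"] -/
theorem bijective_mkQ_comp_inclusion_harmonic (hdT : Dense (T.domain : Set E)) (hcS : S.IsClosed)
    (hST : LinearMap.range T.toFun ≤ (LinearMap.ker S.toFun).map S.domain.subtype) :
    Function.Bijective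
      ((((LinearMap.range T.toFun).topologicalClosure).comap
          ((LinearMap.ker S.toFun).map S.domain.subtype).subtype).mkQ ∘ₗ
        Submodule.inclusion (inf_le_left :
          (LinearMap.ker S.toFun).map S.domain.subtype ⊓ (LinearMap.ker T†.toFun).map T†.domain.subtype ≤
            (LinearMap.ker S.toFun).map S.domain.subtype)) :=
  bijective_mkQ_comp_inclusion inf_le_left (le_of_eq (ker_eq_inf_sup_closure_range hdT hcS hST))
    (isOrtho_inf_closure_range hdT)

/-- `𝔥 ≃ₗ Ker S ⧸ cl Im T` (a linear isomorphism exists). [cite: Bei2014, §1 p. 5; ArnoldFalkWinther2010, §3.1.3] -/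
theorem nonempty_linearEquiv_harmonic_quotient_closure_range (hdT : Dense (T.domain : Set E))
    (hcS : S.IsClosed) (hST : LinearMap.range T.toFun ≤ (LinearMap.ker S.toFun).map S.domain.subtype) :
    Nonempty (↥((LinearMap.ker S.toFun).map S.domain.subtype ⊓ (LinearMap.ker T†.toFun).map T†.domain.subtype)
      ≃ₗ[𝕜] (↥((LinearMap.ker S.toFun).map S.domain.subtype) ⧸
        ((LinearMap.range T.toFun).topologicalClosure).comap
          ((LinearMap.ker S.toFun).map S.domain.subtype).subtype)) :=
  ⟨LinearEquiv.ofBijective _ (bijective_mkQ_comp_inclusion_harmonic hdT hcS hST)⟩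

/-- **Hodge isomorphism for a closed complex: `𝔥 ≅ Ker S / Im T`** — when `Im T` is closed, "harmonic vector ↦
cohomology class" is a linear bijection onto the (honest) cohomology `Ker S / Im T`.
[cite: ArnoldFalkWinther2010, §3.1.3 "or, for a closed complex, to the cohomology space `𝔷^k/𝔅^k`"; Bei2014, §1 Prop 1.2] -/
theorem bijective_mkQ_comp_inclusion_harmonic_of_isClosed_range (hdT : Dense (T.domain : Set E))
    (hcS : S.IsClosed) (hST : LinearMap.range T.toFun ≤ (LinearMap.ker S.toFun).map S.domain.subtype)
    (hRT : IsClosed ((LinearMap.range T.toFun : Submodule 𝕜 F) : Set F)) :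
    Function.Bijective
      (((LinearMap.range T.toFun).comap ((LinearMap.ker S.toFun).map S.domain.subtype).subtype).mkQ ∘ₗ
        Submodule.inclusion (inf_le_left :
          (LinearMap.ker S.toFun).map S.domain.subtype ⊓ (LinearMap.ker T†.toFun).map T†.domain.subtype ≤
            (LinearMap.ker S.toFun).map S.domain.subtype)) :=
  bijective_mkQ_comp_inclusion inf_le_left (le_of_eq (ker_eq_inf_sup_range hdT hcS hST hRT))
    ((isOrtho_inf_closure_range hdT).mono_right (Submodule.le_topologicalClosure _))

/-- `𝔥 ≃ₗ Ker S ⧸ Im T` for `Im T` closed. [cite: ArnoldFalkWinther2010, §3.1.3; Bei2014, §1 Prop 1.2] -/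
theorem nonempty_linearEquiv_harmonic_quotient_range (hdT : Dense (T.domain : Set E)) (hcS : S.IsClosed)
    (hST : LinearMap.range T.toFun ≤ (LinearMap.ker S.toFun).map S.domain.subtype)
    (hRT : IsClosed ((LinearMap.range T.toFun : Submodule 𝕜 F) : Set F)) :
    Nonempty (↥((LinearMap.ker S.toFun).map S.domain.subtype ⊓ (LinearMap.ker T†.toFun).map T†.domain.subtype)
      ≃ₗ[𝕜] (↥((LinearMap.ker S.toFun).map S.domain.subtype) ⧸
        (LinearMap.range T.toFun).comap ((LinearMap.ker S.toFun).map S.domain.subtype).subtype)) :=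
  ⟨LinearEquiv.ofBijective _ (bijective_mkQ_comp_inclusion_harmonic_of_isClosed_range hdT hcS hST hRT)⟩

/-! ### The dual complex `H₃ →S* H₂ →T* H₁`: `𝔥 ≅ Ker T* / cl Im S*` -/

section Dual

variable [CompleteSpace G]

/-- `Ker T* = 𝔥 ⊕ cl Im S*` (the weak Hodge decomposition of the cocycles of the dual complex).
[cite: Bei2014, §1 Prop 1.1; BruningLesch1992, §2 (2.8b), Lemma 2.1] -/
theorem pmapKer_adjoint_eq_harmonic_sup_closure_range_adjoint (hdT : Dense (T.domain : Set E))
    (hdS : Dense (S.domain : Set F)) (hcS : S.IsClosed)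
    (hST : LinearMap.range T.toFun ≤ (LinearMap.ker S.toFun).map S.domain.subtype) :
    (LinearMap.ker T†.toFun).map T†.domain.subtype =
      ((LinearMap.ker S.toFun).map S.domain.subtype ⊓ (LinearMap.ker T†.toFun).map T†.domain.subtype) ⊔
        (LinearMap.range S†.toFun).topologicalClosure := by
  have h := ker_eq_inf_sup_closure_range (T := S†) (S := T†) (dense_adjoint_domain_of_isClosed hdS hcS)
    (LinearPMap.adjoint_isClosed hdT) (range_adjoint_le_pmapKer_adjoint hdS hST)
  rw [adjoint_adjoint_of_isClosed hdS hcS, inf_comm] at h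
  exact h

/-- **Weak de Rham isomorphism for the dual complex: `𝔥 ≅ Ker T* / cl Im S*`** ("`𝓗^i(H_j, D_j) ≅
H̄^{n−i}(H_j, (D_j)*)` where in the second case we mean the cohomology of the dual Hilbert complex").
[cite: Bei2014, §1 p. 5; ArnoldFalkWinther2010, §3.1.3 "harmonic forms both for the original complex and the dual complex"] -/
theorem bijective_mkQ_comp_inclusion_harmonic_dual (hdT : Dense (T.domain : Set E))
    (hdS : Dense (S.domain : Set F)) (hcS : S.IsClosed)
    (hST : LinearMap.range T.toFun ≤ (LinearMap.ker S.toFun).map S.domain.subtype) :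
    Function.Bijective
      ((((LinearMap.range S†.toFun).topologicalClosure).comap
          ((LinearMap.ker T†.toFun).map T†.domain.subtype).subtype).mkQ ∘ₗ
        Submodule.inclusion (inf_le_right :
          (LinearMap.ker S.toFun).map S.domain.subtype ⊓ (LinearMap.ker T†.toFun).map T†.domain.subtype ≤
            (LinearMap.ker T†.toFun).map T†.domain.subtype)) :=
  bijective_mkQ_comp_inclusion inf_le_right
    (le_of_eq (pmapKer_adjoint_eq_harmonic_sup_closure_range_adjoint hdT hdS hcS hST))
    (isOrtho_inf_closure_range_adjoint hdS hcS)

/-- `𝔥 ≃ₗ Ker T* ⧸ cl Im S*`. [cite: Bei2014, §1 p. 5] -/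
theorem nonempty_linearEquiv_harmonic_quotient_closure_range_adjoint (hdT : Dense (T.domain : Set E))
    (hdS : Dense (S.domain : Set F)) (hcS : S.IsClosed)
    (hST : LinearMap.range T.toFun ≤ (LinearMap.ker S.toFun).map S.domain.subtype) :
    Nonempty (↥((LinearMap.ker S.toFun).map S.domain.subtype ⊓ (LinearMap.ker T†.toFun).map T†.domain.subtype)
      ≃ₗ[𝕜] (↥((LinearMap.ker T†.toFun).map T†.domain.subtype) ⧸
        ((LinearMap.range S†.toFun).topologicalClosure).comap
          ((LinearMap.ker T†.toFun).map T†.domain.subtype).subtype)) :=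
  ⟨LinearEquiv.ofBijective _ (bijective_mkQ_comp_inclusion_harmonic_dual hdT hdS hcS hST)⟩

/-- **`𝔥 ≅ Ker T* / Im S*` for `Im S` closed** (then `Im S*` is closed, Kato IV Thm 5.13).
[cite: Bei2014, §1 Prop 1.4 "`𝓗^i ≅ H^i ≅ H^{n−i}((D_j)*)`"; Kato1966, IV §5.2 Thm 5.13] -/
theorem bijective_mkQ_comp_inclusion_harmonic_dual_of_isClosed_range (hdT : Dense (T.domain : Set E))
    (hdS : Dense (S.domain : Set F)) (hcS : S.IsClosed)
    (hST : LinearMap.range T.toFun ≤ (LinearMap.ker S.toFun).map S.domain.subtype)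
    (hRS : IsClosed ((LinearMap.range S.toFun : Submodule 𝕜 G) : Set G)) :
    Function.Bijective
      (((LinearMap.range S†.toFun).comap ((LinearMap.ker T†.toFun).map T†.domain.subtype).subtype).mkQ ∘ₗ
        Submodule.inclusion (inf_le_right :
          (LinearMap.ker S.toFun).map S.domain.subtype ⊓ (LinearMap.ker T†.toFun).map T†.domain.subtype ≤
            (LinearMap.ker T†.toFun).map T†.domain.subtype)) := by
  have hcl : (LinearMap.range S†.toFun).topologicalClosure = LinearMap.range S†.toFun :=
    (isClosed_range_adjoint_of_isClosed_range hdS hRS).submodule_topologicalClosure_eq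
  have hsup := pmapKer_adjoint_eq_harmonic_sup_closure_range_adjoint hdT hdS hcS hST
  rw [hcl] at hsup
  exact bijective_mkQ_comp_inclusion inf_le_right (le_of_eq hsup)
    ((isOrtho_inf_closure_range_adjoint hdS hcS).mono_right (Submodule.le_topologicalClosure _))

/-- `𝔥 ≃ₗ Ker T* ⧸ Im S*` for `Im S` closed. [cite: Bei2014, §1 Prop 1.4] -/
theorem nonempty_linearEquiv_harmonic_quotient_range_adjoint (hdT : Dense (T.domain : Set E))
    (hdS : Dense (S.domain : Set F)) (hcS : S.IsClosed)
    (hST : LinearMap.range T.toFun ≤ (LinearMap.ker S.toFun).map S.domain.subtype)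
    (hRS : IsClosed ((LinearMap.range S.toFun : Submodule 𝕜 G) : Set G)) :
    Nonempty (↥((LinearMap.ker S.toFun).map S.domain.subtype ⊓ (LinearMap.ker T†.toFun).map T†.domain.subtype)
      ≃ₗ[𝕜] (↥((LinearMap.ker T†.toFun).map T†.domain.subtype) ⧸
        (LinearMap.range S†.toFun).comap ((LinearMap.ker T†.toFun).map T†.domain.subtype).subtype)) :=
  ⟨LinearEquiv.ofBijective _
    (bijective_mkQ_comp_inclusion_harmonic_dual_of_isClosed_range hdT hdS hcS hST hRS)⟩

end Dual

/-! ### Harmonic representatives: existence, uniqueness, least norm -/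

/-- **Every `S`-closed vector has a unique harmonic representative of its reduced class**: for `x ∈ Ker S`
there is exactly one `h ∈ 𝔥 = Ker S ∩ Ker T*` with `x − h ∈ cl Im T` (`Ker S = 𝔥 ⊕ cl Im T`, orthogonal).
[cite: Bei2014, §1 Prop 1.1 and the weak de Rham isomorphism; ArnoldFalkWinther2010, §3.1.3] -/
theorem existsUnique_harmonic_sub_mem_closure_range (hdT : Dense (T.domain : Set E)) (hcS : S.IsClosed)
    (hST : LinearMap.range T.toFun ≤ (LinearMap.ker S.toFun).map S.domain.subtype)
    {x : F} (hx : x ∈ (LinearMap.ker S.toFun).map S.domain.subtype) :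
    ∃! h : F, h ∈ (LinearMap.ker S.toFun).map S.domain.subtype ⊓ (LinearMap.ker T†.toFun).map T†.domain.subtype
      ∧ x - h ∈ (LinearMap.range T.toFun).topologicalClosure := by
  have hx' : x ∈ ((LinearMap.ker S.toFun).map S.domain.subtype ⊓
      (LinearMap.ker T†.toFun).map T†.domain.subtype) ⊔ (LinearMap.range T.toFun).topologicalClosure := by
    rw [← ker_eq_inf_sup_closure_range hdT hcS hST]
    exact hx
  obtain ⟨h, hh, b, hb, rfl⟩ := Submodule.mem_sup.1 hx'
  refine ⟨h, ⟨hh, by rwa [add_sub_cancel_left]⟩, ?_⟩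
  rintro h' ⟨hh', hb'⟩
  -- `h' − h = (h + b − h) − (h + b − h') ∈ cl Im T`, and `h' − h ∈ 𝔥 ⟂ cl Im T`
  have hmem : h' - h ∈ (LinearMap.range T.toFun).topologicalClosure := by
    have e : h' - h = (h + b - h) - (h + b - h') := by abel
    rw [e]
    exact Submodule.sub_mem _ (by rwa [add_sub_cancel_left]) hb'
  have h0 : h' - h = 0 :=
    inner_self_eq_zero.1 ((isOrtho_inf_closure_range hdT).inner_eq (Submodule.sub_mem _ hh' hh) hmem)
  exact sub_eq_zero.1 h0

/-- **Hodge theorem for a closed complex: every cohomology class has a unique harmonic representative** —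
for `Im T` closed and `x ∈ Ker S` there is exactly one `h ∈ 𝔥` with `x − h ∈ Im T`.
[cite: ArnoldFalkWinther2010, §3.1.3 "for a closed complex, to the cohomology space `𝔷^k/𝔅^k`"; Bei2014, §1 Prop 1.2] -/
theorem existsUnique_harmonic_sub_mem_range (hdT : Dense (T.domain : Set E)) (hcS : S.IsClosed)
    (hST : LinearMap.range T.toFun ≤ (LinearMap.ker S.toFun).map S.domain.subtype)
    (hRT : IsClosed ((LinearMap.range T.toFun : Submodule 𝕜 F) : Set F))
    {x : F} (hx : x ∈ (LinearMap.ker S.toFun).map S.domain.subtype) :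
    ∃! h : F, h ∈ (LinearMap.ker S.toFun).map S.domain.subtype ⊓ (LinearMap.ker T†.toFun).map T†.domain.subtype
      ∧ x - h ∈ LinearMap.range T.toFun := by
  have h := existsUnique_harmonic_sub_mem_closure_range hdT hcS hST hx
  rwa [hRT.submodule_topologicalClosure_eq] at h

omit [CompleteSpace F] in
/-- Pythagoras in `Ker S = 𝔥 ⊕ cl Im T`: `‖h + b‖² = ‖h‖² + ‖b‖²` for `h ∈ 𝔥`, `b ∈ cl Im T`.
[cite: ArnoldFalkWinther2010, §3.1.3 (`𝔥^k = 𝔷^k ∩ 𝔅^{k⊥}`, "the orthogonal complement of `𝔅^k` in `𝔷^k`")] -/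
theorem norm_add_sq_of_mem_harmonic_of_mem_closure_range (hdT : Dense (T.domain : Set E)) {h b : F}
    (hh : h ∈ (LinearMap.ker S.toFun).map S.domain.subtype ⊓ (LinearMap.ker T†.toFun).map T†.domain.subtype)
    (hb : b ∈ (LinearMap.range T.toFun).topologicalClosure) :
    ‖h + b‖ ^ 2 = ‖h‖ ^ 2 + ‖b‖ ^ 2 :=
  norm_add_sq_of_isOrtho (isOrtho_inf_closure_range hdT) hh hb

omit [CompleteSpace F] in
/-- **The harmonic representative is the element of least norm in its (reduced) class**: `‖h‖ ≤ ‖h + b‖`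
for `h ∈ 𝔥` and `b ∈ cl Im T`. [cite: ArnoldFalkWinther2010, §3.1.3 (`𝔥 = 𝔷 ∩ 𝔅^⊥`)] -/
theorem norm_le_norm_add_of_mem_harmonic (hdT : Dense (T.domain : Set E)) {h b : F}
    (hh : h ∈ (LinearMap.ker S.toFun).map S.domain.subtype ⊓ (LinearMap.ker T†.toFun).map T†.domain.subtype)
    (hb : b ∈ (LinearMap.range T.toFun).topologicalClosure) :
    ‖h‖ ≤ ‖h + b‖ := by
  have h1 := norm_add_sq_of_mem_harmonic_of_mem_closure_range hdT hh hb
  have h2 : ‖h‖ ^ 2 ≤ ‖h + b‖ ^ 2 := by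
    rw [h1]
    exact le_add_of_nonneg_right (sq_nonneg _)
  exact (pow_le_pow_iff_left₀ (norm_nonneg _) (norm_nonneg _) two_ne_zero).1 h2

omit [CompleteSpace F] in
/-- … and it is the only element of least norm: `‖h + b‖ = ‖h‖` with `h ∈ 𝔥`, `b ∈ cl Im T` forces `b = 0`.
[cite: ArnoldFalkWinther2010, §3.1.3 (`𝔥 = 𝔷 ∩ 𝔅^⊥`)] -/
theorem eq_zero_of_norm_add_eq_norm_of_mem_harmonic (hdT : Dense (T.domain : Set E)) {h b : F}
    (hh : h ∈ (LinearMap.ker S.toFun).map S.domain.subtype ⊓ (LinearMap.ker T†.toFun).map T†.domain.subtype)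
    (hb : b ∈ (LinearMap.range T.toFun).topologicalClosure) (heq : ‖h + b‖ = ‖h‖) :
    b = 0 := by
  have h1 := norm_add_sq_of_mem_harmonic_of_mem_closure_range hdT hh hb
  rw [heq] at h1
  have h2 : ‖b‖ ^ 2 = 0 := by linarith
  exact norm_eq_zero.1 ((pow_eq_zero_iff two_ne_zero).1 h2)

end Literature.Analysis.InnerProduct
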